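import Literature.Computability.Complexity.MurrayWilliams2018EasyWitness
import Literature.Computability.MetaComplexity.TruthTablesProofs
import HarnessLib

/-!
# Circuit complexity of strings (Murray–Williams 2018, §2) and the bad inputs of a verifier
# without witness circuits (proof of Lemma 4.1, first step)

Companion of `MurrayWilliams2018EasyWitness.lean` (the Easy Witness Lemma for low nondeterministic
time, Murray–Williams 2018, Lemma 4.1, as the named fact `MurrayWilliams2018_lemma_4_1_ae`, and
the notion `HasWitnessCircuits`). The printed proof of Lemma 4.1 (STOC text p. 12; SIAM J. Comput.
version p. 16, display (4.2)) begins: "assume `NTIME[t(n)]` does not have `w(n)`-size witness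
circuits, i.e., there is some … verifier `V` such that there are infinitely many "bad" inputs `x`,
where there is a `yₓ` of length `t(|x|)` such that `V(x, yₓ)` accepts, yet all such `yₓ` have
circuit complexity greater than `w(|x|)`", the circuit complexity `CC(y)` of a STRING being that
of "the `ℓ`-input function defined by the truth table `y 1 0^{2^ℓ - |y| - 1}`", `2^ℓ` the least
power of two `≥ |y| + 1` (§2, "Circuit complexity of strings"). This file vendors that notion
over the tree's circuits and PROVES this first step for the tree's (encoded, eventual) notion of
witness circuits:

* `padTable y`, `stringCC y` — the padded table and `CC(y)` over the full binary basis `B₂`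
  (`circuitSizeOver B2`, `MetaComplexity.ofTruthTable`; the tree enumerates the cube by
  `MetaComplexity.boolFunEquivFin` rather than lexicographically — a renaming of the input
  variables, under which circuit size is invariant);
* `exists_prefix_truthTable_of_stringCC_le` — `CC(y) ≤ w` gives a `B₂`-circuit with `≤ w` gates
  whose truth table has `y` as a prefix (the encoded form used by `HasWitnessCircuits`; the
  minimum `circuitSizeOver B2 f` is attained, `MetaComplexity.exists_computes_B2_size_eq_holds`);
* `NVerifier.exists_bad_input`, `NVerifier.frequently_bad_input` — if `V : NVerifier t L` has no
  witness circuits of size `w` (the `V`-instance of `¬ HasWitnessCircuits t L w`), then beyond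
  every length — i.e. at infinitely many lengths — there is an `x ∈ L` all of whose accepted
  witnesses inside `V`'s length bound have `CC > w |x|` (display (4.2)); and
  `exists_verifier_bad_inputs_of_not_NTIMEHasWitnessCircuits`, the same from
  `¬ NTIMEHasWitnessCircuits t w`.

Nothing else of the proof of Lemma 4.1 is here (its remaining ingredients — Thm. 3.1, Umans'
generator Thm. 2.1, the advice-taking simulation — are discussed in the review section of
`MurrayWilliams2018EasyWitness.lean`). `lean search` (2026-08-15): no prior `stringCC` /
circuit complexity of strings in the tree (`Kolmogorov.lean` has time-bounded Kolmogorov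
complexity, a different measure); `exists_circuit_truthTable_prefix`
(`MurrayWilliams2018EasyWitnessSanity.lean`) is the trivial upper bound `CC(y) ≤ univBound ℓ`.

## References

* C. D. Murray, R. R. Williams, *Circuit lower bounds for nondeterministic quasi-polytime: an easy
  witness lemma for NP and NQP*, STOC 2018, §2 ("Circuit complexity of strings and pseudorandom
  generators"), proof of Lemma 4.1 (display (5) of the STOC text = (4.2) of the SIAM J. Comput.
  version 49(5), 2020, p. STOC18-314) [MurrayWilliams2018].
* R. Williams, *Nonuniform ACC circuit lower bounds*, J. ACM 61 (2014), §5 (witness circuits)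
  [Williams2014].
-/

noncomputable section

namespace Literature.Computability.Complexity

open Filter

/-! ### Circuit complexity of strings (MW §2) -/

/-- The padded table `y 1 0^{2^ℓ - |y| - 1}` of a string `y`, where `2^ℓ` is the least power of
two with `2^ℓ ≥ |y| + 1`, i.e. `ℓ = ⌈log₂ (|y| + 1)⌉ = Nat.clog 2 (|y| + 1)` (Murray–Williams
2018, §2, "Circuit complexity of strings"). [cite: MurrayWilliams2018, §2] -/
def padTable (y : List Bool) : List Bool :=
  y ++ true :: List.replicate (2 ^ Nat.clog 2 (y.length + 1) - (y.length + 1)) false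

/-- The padded table has length `2^ℓ`, `ℓ = ⌈log₂ (|y| + 1)⌉`. [cite: MurrayWilliams2018, §2] -/
theorem length_padTable (y : List Bool) :
    (padTable y).length = 2 ^ Nat.clog 2 (y.length + 1) := by
  have h : y.length + 1 ≤ 2 ^ Nat.clog 2 (y.length + 1) := Nat.le_pow_clog one_lt_two _
  simp only [padTable, List.length_append, List.length_cons, List.length_replicate]
  omega

/-- `y` is a prefix of its padded table. [cite: MurrayWilliams2018, §2] -/
theorem prefix_padTable (y : List Bool) : y <+: padTable y :=
  List.prefix_append _ _

/-- **The circuit complexity `CC(y)` of a string `y`** (Murray–Williams 2018, §2: "We define the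
circuit complexity of `y`, or `CC(y)`, to be the circuit complexity of the `ℓ`-input function
defined by the truth table `y 1 0^{2^ℓ - |y| - 1}`", `2^ℓ` the least power of two `≥ |y| + 1`):
the least size of a `B₂`-circuit (`circuitSizeOver B2`) computing the function whose truth table
in the tree's enumeration (`MetaComplexity.ofTruthTable`) is `padTable y`. [cite: MurrayWilliams2018, §2] -/
def stringCC (y : List Bool) : ℕ :=
  circuitSizeOver B2 (MetaComplexity.ofTruthTable (padTable y) (length_padTable y))

/-- A string of circuit complexity `≤ w` is a prefix of the truth table of a `B₂`-circuit with at
most `w` gates — the encoded form of "`y` has circuit complexity at most `w`" used by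
`HasWitnessCircuits` (module docstring of `MurrayWilliams2018EasyWitness.lean`: "`CC(y) ≤ w` in the
printed sense gives such a `W`"). [cite: MurrayWilliams2018, §2] -/
theorem exists_prefix_truthTable_of_stringCC_le {y : List Bool} {w : ℕ} (h : stringCC y ≤ w) :
    ∃ (m : ℕ) (W : Circuit (Fin m)), W.IsOver B2 ∧ W.size ≤ w ∧
      y <+: MetaComplexity.truthTable W.eval := by
  obtain ⟨C, hB, hC, hsize⟩ := MetaComplexity.exists_computes_B2_size_eq_holds
    (MetaComplexity.ofTruthTable (padTable y) (length_padTable y))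
  refine ⟨_, C, hB, hsize ▸ h, ?_⟩
  have hfun : C.eval = MetaComplexity.ofTruthTable (padTable y) (length_padTable y) :=
    funext hC
  rw [hfun, MetaComplexity.truthTable_ofTruthTable]
  exact prefix_padTable y

/-! ### Bad inputs of a verifier without witness circuits (proof of Lemma 4.1, (4.2)) -/

/-- **Bad inputs** (Murray–Williams 2018, proof of Lemma 4.1, display (4.2) of the SIAM version:
"there is some … verifier `V` such that there are infinitely many "bad" inputs `x`, where there is
a `yₓ` … such that `V(x, yₓ)` accepts, yet all such `yₓ` have circuit complexity greater than
`w(|x|)`"), for the tree's verifiers: if `V : NVerifier t L` has no threshold beyond which every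
`x ∈ L` has an accepted witness encoded by a `B₂`-circuit with `≤ w |x|` gates (the `V`-instance of
`¬ HasWitnessCircuits t L w`), then beyond every length `n₀` some `x ∈ L` has ALL its accepted
witnesses inside `V`'s length bound of string circuit complexity `> w |x|` (contrapositive of
`exists_prefix_truthTable_of_stringCC_le`; such an `x` has accepted witnesses at all, by
`V.mem_iff`). [cite: MurrayWilliams2018, Lemma 4.1 (proof)] -/
theorem NVerifier.exists_bad_input {t : ℕ → ℕ} {L : Language Bool} {w : ℕ → ℕ}
    (V : NVerifier t L)
    (hV : ¬ ∃ n₀ : ℕ, ∀ x ∈ L, n₀ ≤ x.length →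
      ∃ (m : ℕ) (W : Circuit (Fin m)) (y : List Bool), W.IsOver B2 ∧ W.size ≤ w x.length ∧
        y.length ≤ V.c * t x.length + V.c ∧ V.rel x y = true ∧
          y <+: MetaComplexity.truthTable W.eval)
    (n₀ : ℕ) :
    ∃ x ∈ L, n₀ ≤ x.length ∧ ∀ y : List Bool, y.length ≤ V.c * t x.length + V.c →
      V.rel x y = true → w x.length < stringCC y := by
  by_contra hcon
  push Not at hcon
  refine hV ⟨n₀, fun x hx hle => ?_⟩
  obtain ⟨y, hylen, hrel, hcc⟩ := hcon x hx hle
  obtain ⟨m, W, hB, hsize, hpre⟩ := exists_prefix_truthTable_of_stringCC_le hcc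
  exact ⟨m, W, y, hB, hsize, hylen, hrel, hpre⟩

/-- The bad inputs occur at infinitely many lengths ("there are infinitely many input lengths
`{nᵢ}` such that, by encoding a bad input `xᵢ` of length `nᵢ` as advice …", proof of Lemma 4.1).
[cite: MurrayWilliams2018, Lemma 4.1 (proof)] -/
theorem NVerifier.frequently_bad_input {t : ℕ → ℕ} {L : Language Bool} {w : ℕ → ℕ}
    (V : NVerifier t L)
    (hV : ¬ ∃ n₀ : ℕ, ∀ x ∈ L, n₀ ≤ x.length →
      ∃ (m : ℕ) (W : Circuit (Fin m)) (y : List Bool), W.IsOver B2 ∧ W.size ≤ w x.length ∧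
        y.length ≤ V.c * t x.length + V.c ∧ V.rel x y = true ∧
          y <+: MetaComplexity.truthTable W.eval) :
    ∃ᶠ n in atTop, ∃ x ∈ L, x.length = n ∧ ∀ y : List Bool,
      y.length ≤ V.c * t x.length + V.c → V.rel x y = true → w x.length < stringCC y := by
  refine frequently_atTop.2 fun n₀ => ?_
  obtain ⟨x, hx, hle, hbad⟩ := V.exists_bad_input hV n₀
  exact ⟨x.length, hle, x, hx, rfl, hbad⟩

/-- From the class-level failure `¬ NTIMEHasWitnessCircuits t w`: some `L ∈ NTIME t` and some
`t`-verifier `V` of `L` have bad inputs at infinitely many lengths (Murray–Williams 2018, proof of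
Lemma 4.1, (4.2)). [cite: MurrayWilliams2018, Lemma 4.1 (proof)] -/
theorem exists_verifier_bad_inputs_of_not_NTIMEHasWitnessCircuits {t w : ℕ → ℕ}
    (h : ¬ NTIMEHasWitnessCircuits t w) :
    ∃ (L : Language Bool) (_ : L ∈ NTIME t) (V : NVerifier t L),
      ∃ᶠ n in atTop, ∃ x ∈ L, x.length = n ∧ ∀ y : List Bool,
        y.length ≤ V.c * t x.length + V.c → V.rel x y = true → w x.length < stringCC y := by
  simp only [NTIMEHasWitnessCircuits, HasWitnessCircuits, not_forall] at h
  obtain ⟨L, hL, V, hV⟩ := h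
  exact ⟨L, hL, V, V.frequently_bad_input hV⟩

end Literature.Computability.Complexity

end
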